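import Summits.HodgeConjecture.HodgeConjecture.Theorems.F0P3cStCharTSPrincipalSeriesUnitary   -- ★ p852355 (F0P2-p06 g19) «PS-UNITARY★» `isSemisimpleRepresentation_cmPrincipalSeries[_cmTorusCharPair]`; brings ★ admissibility-of-Iwasawa, ★ Iwasawa, ★ `cmTorusCharPair`
import Summits.HodgeConjecture.HodgeConjecture.Theorems.F0P2nFrobeniusFunctional             -- ★ (F0P2-p01) Frobenius, easy direction: `exists_intertwiningMap_cmPrincipalSeries_of_functional`, `twist_comp_proj_character_apply`; brings ★ `Gqs`
import Mathlib.LinearAlgebra.Eigenspace.Triangularizable                                      -- `Module.End.exists_eigenvalue`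
import HarnessLib

/-!
# F0 · P3c · line LH6 «StCharTS» — «KEYS-RED ⟸ SECOND EIGENFUNCTIONAL★»: a principal series `i_G(χ)` of `U(Φ_N)(L⁺_v)` carrying a
# `(B, χ δ_B^{1/2})`-eigenfunctional NOT proportional to evaluation at `1` is REDUCIBLE; conversely for `|χ| = 1` (FILE 1 of 2; FILE 2 docks RUNG 0's
# `hKeysRed3` on it in the pair currency) (Bernstein–Zelevinsky 1976 Prop. 2.28, 1977 §2.3; Casselman 1995 §3.2, §6.3–6.4; Keys 1984 §3, §7)

Cell `pub/hodgecm-mathlib`, crux H413 = `stmt-HodgeConjecture-24833` (lane `--supports … --as helper`), route HCCMUnconditional; seat F0P2-p06 (g20), DEFAULT brick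
(desk F0P3-plan (g18) WORD 2026-09-02T19:37:24Z, fences F1–F4; SIGSHEET v1 03a72a050e2cdd9a).  THEOREMS ONLY (no definition ∕ instance ∕ notation ∕ named fact ∕ `sorry`); ★-only imports + Mathlib.

WHAT.  `G = U(Φ_N)(L⁺_v)` (the CM carrier `↥(unitaryGroupOfForm (conjLocal L c v) (cmLocalForm L N v))`, `= Gqs L v` for `N = 3`), `B = T·U` its Borel (★ `cmBorelTriple`),
`I = i_G(χ)` = ★ `cmPrincipalSeries L N v χ` (normalised smooth induction, functions `f` with `f(p g) = χ(p) δ_B^{1/2}(p) f(g)`, right translation).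
By Frobenius reciprocity [BernsteinZelevinsky1976 Prop. 2.28] `End_G(I) ≅ Hom_B(I|_B, χ δ_B^{1/2})` = the space of `(B, χ δ_B^{1/2})`-EIGENFUNCTIONALS
`ℓ : I → ℂ`, `ℓ(I(p) f) = χ(p) δ_B^{1/2}(p) ℓ(f)`; the identity corresponds to EVALUATION AT ONE `f ↦ f(1)`.  This file proves, in house:
* §1 (linear algebra ∕ Schur for admissible representations) **`exists_ne_bot_ne_top_of_intertwiningMap_of_not_smul`**: a `G`-endomorphism `Φ` of a representation
  that stabilises a non-zero finite-dimensional subspace and is not a scalar has a `G`-stable `⊥ ≠ ker(Φ − c) ≠ ⊤` (`c` an eigenvalue on that subspace);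
  **`exists_ne_bot_ne_top_of_isAdmissible_of_not_smul`**: hence an ADMISSIBLE representation of a group with a compact open subgroup and a non-scalar
  `G`-endomorphism is reducible (the finite-dimensional subspace is `V^K`, `K` = compact open ∩ an open stabiliser).
* §2 **`exists_ne_bot_ne_top_of_eigenfunctional`** (every `N`, every finite `v`, every `χ`): a `(B, χ δ_B^{1/2})`-eigenfunctional `ℓ` on `I` with `ℓ ≠ c · ev₁` for
  every `c` makes `I` REDUCIBLE (`∃ N, ⊥ ≠ N ≠ ⊤`) — Frobenius (★ `exists_intertwiningMap_cmPrincipalSeries_of_functional`: `Φ` with `(Φ f)(g) = ℓ(I(g) f)`, so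
  `(Φ f)(1) = ℓ f` and `Φ` is not a scalar), admissibility (★ `isAdmissible_cmPrincipalSeries_of_iwasawa` over ★ `exists_borel_mul_mem_cmLocalIntegralLevel`), §1.
* §3 the converse **`exists_eigenfunctional_of_ne_bot_ne_top`** for a COMPLETELY REDUCIBLE `I` (e.g. `|χ| = 1`, ★ «PS-UNITARY★»): `⊥ ≠ N ≠ ⊤` with invariant
  complement `N'` gives `ℓ := ev₁ ∘ pr_N`, a `(B, χ δ_B^{1/2})`-eigenfunctional not proportional to `ev₁` (`ev₁` vanishes on no non-zero subrepresentation).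
* (companion file ★-to-be `F0P3cStCharTSKeysRedThreeOfEigenfunctional`, `N = 3`, `v` non-split, RUNG 0's PAIR currency ★ `cmTorusCharPair`): RUNG 0's outer named input
  `hKeysRed3` (★ `F0P3cStCharTSRung0Eight` :133: Keys' reducibility, case (3) ⇐ [Keys1984 §7 Thm. (1); Rogawski1990 §12.2 (3)]) ⟺ «for continuous `χ₁, χ₂` with
  `χ₁|_{F_v^×} = 1`, `χ₁ ≠ 1`, `i_G(χ₁, χ₂)` carries a `(B, χ δ_B^{1/2})`-eigenfunctional not proportional to `ev₁`» (print's commuting-algebra form, `dim End_G i_G(χ) ≥ 2`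
  [Keys1984 §3; Casselman1995 §6.4]) — by §2 (⇐) and §3 + ★ «PS-UNITARY★» (⇒).
HONEST LABEL: HC_CM is proved only modulo the 7 printed citations (2 remaining named inputs: hLiu418 = `stmt-HodgeConjecture-24832`, h413 = `stmt-HodgeConjecture-24833`)
until rung 0 closes; this file closes no organ and moves no count — it is the algebraic junction through which an intertwining-operator road to Keys (3) would pass.

## References
* [BernsteinZelevinsky1976] I. N. Bernstein, A. V. Zelevinsky, Russian Math. Surveys 31:3 (1976), Prop. 2.28 (Frobenius reciprocity), 2.25 (c).
* [BernsteinZelevinsky1977] I. N. Bernstein, A. V. Zelevinsky, Ann. Sci. ÉNS 10 (1977), §2.3, Prop. 1.9.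
* [Casselman1995] W. Casselman, *Introduction to the theory of admissible representations of p-adic reductive groups* (1995), §3.2 (Frobenius), §6.3–6.4.
* [Keys1984] D. Keys, *Principal series representations of special unitary groups over local fields*, Compositio Math. 51 (1984), §3, §7 Thm. (1) p. 126.
* [Rogawski1990] J. D. Rogawski, *Automorphic Representations of Unitary Groups in Three Variables*, Ann. of Math. Stud. 123 (1990), §12.1 p. 171, §12.2 pp. 173–174.
-/

set_option autoImplicit false
-- the mandated namespace has the single-problem summit's repeated segment (`HodgeConjecture.HodgeConjecture`)
set_option linter.dupNamespace false

noncomputable section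

open NumberField IsDedekindDomain
open scoped Matrix
open Literature.NumberTheory.Rogawski1990 Literature.NumberTheory.Automorphic Literature.NumberTheory.Automorphic.UnitaryGroup

namespace Summit.HodgeConjecture.HodgeConjecture.Cruxes.H413.F0P3cStCharTSRedOfEigenfunctional

/-! ## §1 A non-scalar endomorphism of an admissible representation cuts out a proper non-zero subrepresentation -/

section Generic

variable {G V : Type*} [Group G] [AddCommGroup V] [Module ℂ V]

/-- **A `G`-endomorphism that is not a scalar and stabilises a non-zero finite-dimensional subspace is reducing**: if `Φ ∈ End_G(ρ)` maps the
finite-dimensional `W ≠ 0` into itself and `Φ ≠ c · id` for every `c`, then for an eigenvalue `c` of `Φ|_W` the `G`-stable `ker (Φ − c)` is `≠ ⊥` (it contains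
the eigenvector) and `≠ ⊤` (else `Φ = c · id`).  [cite: Casselman1995, §2.1; Prop. 2.1.7 (Schur's lemma for admissible representations)] -/
theorem exists_ne_bot_ne_top_of_intertwiningMap_of_not_smul (ρ : Representation ℂ G V) (Φ : ρ.IntertwiningMap ρ)
    (W : Submodule ℂ V) [FiniteDimensional ℂ W] (hW : W ≠ ⊥) (hΦW : ∀ w ∈ W, Φ w ∈ W) (hΦ : ∀ c : ℂ, ∃ v, Φ v ≠ c • v) :
    ∃ N : Subrepresentation ρ, N ≠ ⊥ ∧ N ≠ ⊤ := by
  haveI : Nontrivial W := Submodule.nontrivial_iff_ne_bot.2 hW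
  have hΦW' : ∀ w ∈ W, Φ.toLinearMap w ∈ W := fun w hw => hΦW w hw
  obtain ⟨c, hc⟩ := Module.End.exists_eigenvalue (Φ.toLinearMap.restrict hΦW')
  obtain ⟨w, hw⟩ := hc.exists_hasEigenvector
  have hw1 : Φ (w : V) = c • (w : V) := by
    have h := congrArg Subtype.val hw.apply_eq_smul
    rw [LinearMap.coe_restrict_apply] at h
    simpa using h
  have hw0 : (w : V) ≠ 0 := fun h => hw.2 (Subtype.ext h)
  refine ⟨(Φ - c • Representation.IntertwiningMap.id ρ).ker, ?_, ?_⟩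
  · intro h
    have hmem : (w : V) ∈ (Φ - c • Representation.IntertwiningMap.id ρ).ker := by
      rw [Representation.IntertwiningMap.mem_ker, Representation.IntertwiningMap.coe_sub, Pi.sub_apply,
        Representation.IntertwiningMap.smul_apply, Representation.IntertwiningMap.id_apply, hw1, sub_self]
    rw [h] at hmem
    exact hw0 ((Submodule.mem_bot ℂ).1 hmem)
  · intro h
    obtain ⟨v, hv⟩ := hΦ c
    have hmem : v ∈ (Φ - c • Representation.IntertwiningMap.id ρ).ker := by
      rw [h]
      exact Submodule.mem_top
    rw [Representation.IntertwiningMap.mem_ker, Representation.IntertwiningMap.coe_sub, Pi.sub_apply,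
      Representation.IntertwiningMap.smul_apply, Representation.IntertwiningMap.id_apply, sub_eq_zero] at hmem
    exact hv hmem

/-- A `G`-endomorphism preserves the `K`-fixed vectors `V^K` for every subgroup `K`. [folklore] -/
theorem intertwiningMap_apply_mem_fixedPoints (ρ : Representation ℂ G V) (Φ : ρ.IntertwiningMap ρ) (K : Subgroup G) {w : V}
    (hw : w ∈ ρ.fixedPoints K) : Φ w ∈ ρ.fixedPoints K := by
  rw [Representation.mem_fixedPoints] at hw ⊢
  intro g hg
  rw [← Representation.IntertwiningMap.isIntertwining (f := Φ) (g := g) (v := w), hw g hg]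

variable [TopologicalSpace G] [IsTopologicalGroup G]

/-- In a SMOOTH representation every vector is fixed by a COMPACT open subgroup, once `G` has one compact open subgroup `K₀` (take `K₀ ∩ Stab(v)`: open
stabiliser, open subgroups are closed). [cite: BernsteinZelevinsky1976, §2.1] -/
theorem exists_isCompact_mem_fixedPoints (ρ : Representation ℂ G V) (hρ : ρ.IsSmooth) (K₀ : Subgroup G) (hK₀o : IsOpen (K₀ : Set G))
    (hK₀c : IsCompact (K₀ : Set G)) (v : V) : ∃ K : OpenSubgroup G, IsCompact (K : Set G) ∧ v ∈ ρ.fixedPoints (K : Subgroup G) := by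
  have hSo : IsOpen (ρ.stabilizerSubgroup v : Set G) := hρ v
  refine ⟨⟨K₀ ⊓ ρ.stabilizerSubgroup v, hK₀o.inter hSo⟩, hK₀c.inter_right ((ρ.stabilizerSubgroup v).isClosed_of_isOpen hSo), ?_⟩
  rw [Representation.mem_fixedPoints]
  intro g hg
  exact (Representation.mem_stabilizerSubgroup ρ v g).1 hg.2

/-- **An ADMISSIBLE representation with a NON-SCALAR `G`-endomorphism is reducible** (when `G` has a compact open subgroup): `Φ v ≠ 0` for some `v` (non-scalar at
`c = 0`); `v ∈ V^K` for a compact open `K`, `V^K` is finite-dimensional (admissibility), `Φ`-stable and `≠ 0`; §1.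
[cite: Casselman1995, Prop. 2.1.7] [cite: BernsteinZelevinsky1976, §2.1, Prop. 2.28] -/
theorem exists_ne_bot_ne_top_of_isAdmissible_of_not_smul (ρ : Representation ℂ G V) (hρ : ρ.IsAdmissible) (K₀ : Subgroup G)
    (hK₀o : IsOpen (K₀ : Set G)) (hK₀c : IsCompact (K₀ : Set G)) (Φ : ρ.IntertwiningMap ρ) (hΦ : ∀ c : ℂ, ∃ v, Φ v ≠ c • v) :
    ∃ N : Subrepresentation ρ, N ≠ ⊥ ∧ N ≠ ⊤ := by
  obtain ⟨v, hv⟩ := hΦ 0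
  rw [zero_smul] at hv
  have hv0 : v ≠ 0 := fun h => hv (by rw [h, map_zero])
  obtain ⟨K, hKc, hvK⟩ := exists_isCompact_mem_fixedPoints ρ hρ.isSmooth K₀ hK₀o hK₀c v
  haveI : Module.Finite ℂ ↥(ρ.fixedPoints (K : Subgroup G)) := hρ.finite_fixedPoints K hKc
  exact exists_ne_bot_ne_top_of_intertwiningMap_of_not_smul ρ Φ (ρ.fixedPoints (K : Subgroup G))
    (fun h => hv0 ((Submodule.mem_bot ℂ).1 (h ▸ hvK))) (fun w hw => intertwiningMap_apply_mem_fixedPoints ρ Φ K hw) hΦ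

end Generic

/-! ## §2 The CM head: a second `(B, χ δ_B^{1/2})`-eigenfunctional on `i_G(χ)` makes it reducible (every `N`, every finite `v`, every `χ`) -/

section CM

variable (L : Type) [Field L] [NumberField L] [IsCMField L] (N : ℕ) (v : HeightOneSpectrum (𝓞 ↥(maximalRealSubfield L)))

set_option synthInstance.maxHeartbeats 400000 in
set_option maxHeartbeats 8000000 in
-- statement∕proof-heavy: the `SmoothInd` carrier of `cmPrincipalSeries` (class of ★ `F0P2nFrobeniusFunctional` §4 ∕ ★ «PS-UNITARY★»)
/-- **«KEYS-RED ⟸ SECOND EIGENFUNCTIONAL★».**  Let `I = i_G(χ)` = ★ `cmPrincipalSeries L N v χ` on `G = U(Φ_N)(L⁺_v)` and let `ℓ : I → ℂ` be a linear functional with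
`ℓ (I(p) f) = χ(proj p) · δ_B^{1/2}(p) · ℓ f` for `p` in the Borel `B = (cmBorelTriple L N v).P` (the shape of ★ K1b ∕ ★ `exists_intertwiningMap_cmPrincipalSeries_of_functional`)
which is NOT proportional to evaluation at one: `∀ c, ∃ f, ℓ f ≠ c · f(1)`.  Then `I` is REDUCIBLE: it has a `G`-stable `⊥ ≠ N ≠ ⊤`.  Proof: Frobenius reciprocity gives
`Φ ∈ End_G(I)` with `(Φ f)(g) = ℓ(I(g) f)`, so `(Φ f)(1) = ℓ f` and `Φ` is not a scalar; `I` is admissible (Iwasawa `G = B·K_v`); §1 at `K₀ = U(Φ_N)(𝒪_v)` (★ `localIntegralLevel`,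
compact open).  [cite: BernsteinZelevinsky1976, Proposition 2.28] [cite: Casselman1995, §3.2, Prop. 2.1.7] [cite: Rogawski1990, §12.1 p. 171; §12.2 p. 173] -/
theorem exists_ne_bot_ne_top_of_eigenfunctional
    (χ : ↥(torusU (conjLocal L (IsCMField.complexConj L) v) (cmLocalForm L N v)) →* ℂˣ) :
    haveI := locallyCompactSpace_cmBorelU L N v
    ∀ ℓ : Representation.SmoothInd (cmBorelTriple L N v).P
        (Representation.twist (((Representation.trivial ℂ ↥(torusU (conjLocal L (IsCMField.complexConj L) v) (cmLocalForm L N v)) ℂ).twist χ).comp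
          (cmBorelTriple L N v).proj) (rootDeltaChar (cmBorelTriple L N v).P)) →ₗ[ℂ] ℂ,
      (∀ (p : ↥(cmBorelTriple L N v).P) (f : _),
        ℓ (cmPrincipalSeries L N v χ p.1 f) =
          ((χ ((cmBorelTriple L N v).proj p) : ℂˣ) : ℂ) * ((rootDeltaChar (cmBorelTriple L N v).P p : ℂˣ) : ℂ) * ℓ f) →
      (∀ c : ℂ, ∃ f, ℓ f ≠ c * f.toFun 1) →
      ∃ N' : Subrepresentation (cmPrincipalSeries L N v χ), N' ≠ ⊥ ∧ N' ≠ ⊤ := by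
  haveI := locallyCompactSpace_cmBorelU L N v
  intro ℓ hℓ hind
  -- `ℓ ≠ 0` (non-proportionality at `c = 0`)
  have hℓ0 : ℓ ≠ 0 := by
    obtain ⟨f, hf⟩ := hind 0
    intro h
    rw [h, LinearMap.zero_apply, zero_mul] at hf
    exact hf rfl
  -- Frobenius: `Φ ∈ End_G(I)` with `(Φ f)(g) = ℓ (I(g) f)`
  have hsm : (cmPrincipalSeries L N v χ).IsSmooth := Representation.isSmooth_smoothInd (cmBorelTriple L N v).P _
  obtain ⟨Φ, -, hΦ⟩ := F0P2nFrobeniusFunctional.exists_intertwiningMap_cmPrincipalSeries_of_functional L N v χ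
    (cmPrincipalSeries L N v χ) hsm ℓ hℓ hℓ0
  have hΦ1 : ∀ f, (Φ f).toFun 1 = ℓ f := fun f => by rw [hΦ f 1, map_one, Module.End.one_apply]
  -- `Φ` is not a scalar: `Φ = c · id` would give `ℓ f = (Φ f)(1) = c · f(1)`
  have hΦns : ∀ c : ℂ, ∃ f, Φ f ≠ c • f := by
    intro c
    obtain ⟨f, hf⟩ := hind c
    refine ⟨f, fun h => hf ?_⟩
    rw [← hΦ1 f, h, Representation.SmoothInd.toFun_smul, Pi.smul_apply, smul_eq_mul]
  -- admissibility (Iwasawa) and the compact open `K₀ = U(Φ_N)(𝒪_v)` read on this carrier (`cmDatum_Local_eq` is `rfl`)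
  have hadm : (cmPrincipalSeries L N v χ).IsAdmissible :=
    isAdmissible_cmPrincipalSeries_of_iwasawa L N v (exists_borel_mul_mem_cmLocalIntegralLevel L N v) χ
  obtain ⟨K₀, hK₀c, hK₀o⟩ : ∃ K₀ : Subgroup ↥(unitaryGroupOfForm (conjLocal L (IsCMField.complexConj L) v) (cmLocalForm L N v)),
      IsCompact (K₀ : Set ↥(unitaryGroupOfForm (conjLocal L (IsCMField.complexConj L) v) (cmLocalForm L N v))) ∧
      IsOpen (K₀ : Set ↥(unitaryGroupOfForm (conjLocal L (IsCMField.complexConj L) v) (cmLocalForm L N v))) :=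
    ⟨cmLocalIntegralLevel L N (Matrix.of fun i j : Fin N => if i.val + j.val + 1 = N then (1 : L) else 0) v,
      isCompact_isOpen_cmLocalIntegralLevel L N (Matrix.of fun i j : Fin N => if i.val + j.val + 1 = N then (1 : L) else 0) v⟩
  exact exists_ne_bot_ne_top_of_isAdmissible_of_not_smul
    (G := ↥(unitaryGroupOfForm (conjLocal L (IsCMField.complexConj L) v) (cmLocalForm L N v)))
    (ρ := cmPrincipalSeries L N v χ) hadm K₀ hK₀o hK₀c Φ hΦns

/-! ## §3 The converse for a completely reducible `i_G(χ)`: a proper non-zero summand yields a second eigenfunctional -/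

set_option synthInstance.maxHeartbeats 400000 in
set_option maxHeartbeats 8000000 in
-- statement∕proof-heavy: the `SmoothInd` carrier of `cmPrincipalSeries` (class of ★ `F0P2nFrobeniusFunctional` §4)
/-- **Evaluation at one is a `(B, χ δ_B^{1/2})`-eigenfunctional on `i_G(χ)`**: `(I(p) f)(1) = f(p) = χ(proj p) δ_B^{1/2}(p) f(1)` (right translation; the defining
left equivariance of the induced model).  [cite: BernsteinZelevinsky1977, §2.3] [cite: Rogawski1990, §12.1 p. 171] -/
theorem toFun_one_apply_borel
    (χ : ↥(torusU (conjLocal L (IsCMField.complexConj L) v) (cmLocalForm L N v)) →* ℂˣ) :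
    haveI := locallyCompactSpace_cmBorelU L N v
    ∀ (p : ↥(cmBorelTriple L N v).P) (f : Representation.SmoothInd (cmBorelTriple L N v).P
        (Representation.twist (((Representation.trivial ℂ ↥(torusU (conjLocal L (IsCMField.complexConj L) v) (cmLocalForm L N v)) ℂ).twist χ).comp
          (cmBorelTriple L N v).proj) (rootDeltaChar (cmBorelTriple L N v).P))),
      (cmPrincipalSeries L N v χ p.1 f).toFun 1 =
        ((χ ((cmBorelTriple L N v).proj p) : ℂˣ) : ℂ) * ((rootDeltaChar (cmBorelTriple L N v).P p : ℂˣ) : ℂ) * f.toFun 1 := by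
  haveI := locallyCompactSpace_cmBorelU L N v
  intro p f
  have h1 : (cmPrincipalSeries L N v χ p.1 f).toFun 1 = f.toFun (1 * p.1) := Representation.toFun_smoothIndRep_apply p.1 f 1
  have h2 := Representation.SmoothInd.toFun_subgroup_mul f p 1
  rw [mul_one] at h2
  rw [h1, one_mul]
  exact h2.trans (F0P2nFrobeniusFunctional.twist_comp_proj_character_apply (cmBorelTriple L N v) χ p (f.toFun 1))

set_option synthInstance.maxHeartbeats 400000 in
set_option maxHeartbeats 8000000 in
-- statement∕proof-heavy: the `SmoothInd` carrier of `cmPrincipalSeries` (class of ★ `F0P2nFrobeniusFunctional` §4)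
/-- **A subrepresentation of `i_G(χ)` on which evaluation at one vanishes is zero**: `f(g) = (I(g) f)(1) = 0` for every `g`. [cite: BernsteinZelevinsky1977, Prop. 1.9 (c)] -/
theorem eq_bot_of_forall_toFun_one_eq_zero
    (χ : ↥(torusU (conjLocal L (IsCMField.complexConj L) v) (cmLocalForm L N v)) →* ℂˣ)
    (N' : Subrepresentation (cmPrincipalSeries L N v χ)) (h : ∀ f ∈ N', f.toFun 1 = 0) : N' = ⊥ := by
  haveI := locallyCompactSpace_cmBorelU L N v
  refine le_bot_iff.1 fun f hf => ?_
  have hf0 : f = 0 := by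
    refine Representation.SmoothInd.ext (funext fun g => ?_)
    have hg := h _ (N'.apply_mem_toSubmodule g hf)
    have hg' : (cmPrincipalSeries L N v χ g f).toFun 1 = f.toFun (1 * g) := Representation.toFun_smoothIndRep_apply g f 1
    rw [hg', one_mul] at hg
    rw [hg]
    rfl
  rw [hf0]
  exact (⊥ : Subrepresentation (cmPrincipalSeries L N v χ)).toSubmodule.zero_mem

set_option synthInstance.maxHeartbeats 400000 in
set_option maxHeartbeats 8000000 in
-- statement∕proof-heavy: the `SmoothInd` carrier of `cmPrincipalSeries` (class of ★ `F0P2nFrobeniusFunctional` §4)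
/-- **The projection onto an invariant summand is a `G`-map**: for complementary subrepresentations `N', N''` of `i_G(χ)` the linear projection onto `N'` along `N''`
commutes with `G` (`g·(n' + n'') = g·n' + g·n''` with `g·n' ∈ N'`, `g·n'' ∈ N''`).  [cite: BernsteinZelevinsky1976, 2.25 (c)] [folklore] -/
theorem exists_equivariant_projection
    (χ : ↥(torusU (conjLocal L (IsCMField.complexConj L) v) (cmLocalForm L N v)) →* ℂˣ)
    (N' N'' : Subrepresentation (cmPrincipalSeries L N v χ)) (hc : IsCompl N' N'') :
    haveI := locallyCompactSpace_cmBorelU L N v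
    ∃ P : Module.End ℂ (Representation.SmoothInd (cmBorelTriple L N v).P
        (Representation.twist (((Representation.trivial ℂ ↥(torusU (conjLocal L (IsCMField.complexConj L) v) (cmLocalForm L N v)) ℂ).twist χ).comp
          (cmBorelTriple L N v).proj) (rootDeltaChar (cmBorelTriple L N v).P))),
      (∀ (g : ↥(unitaryGroupOfForm (conjLocal L (IsCMField.complexConj L) v) (cmLocalForm L N v))) (f : _),
        P (cmPrincipalSeries L N v χ g f) = cmPrincipalSeries L N v χ g (P f)) ∧
      (∀ f, f ∈ N' → P f = f) ∧ (∀ f, f ∈ N'' → P f = 0) := by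
  haveI := locallyCompactSpace_cmBorelU L N v
  -- the complement at the level of submodules
  have hc' : IsCompl N'.toSubmodule N''.toSubmodule := by
    refine ⟨disjoint_iff.2 ?_, codisjoint_iff.2 ?_⟩
    · rw [← Subrepresentation.toSubmodule_inf, disjoint_iff.1 hc.1]; rfl
    · rw [← Subrepresentation.toSubmodule_sup, codisjoint_iff.1 hc.2]; rfl
  -- the projection `P` onto `N'` along `N''`, as an opaque linear map with its four defining properties
  obtain ⟨P, hP1, hP2, hPm, hPs⟩ : ∃ P : Module.End ℂ (Representation.SmoothInd (cmBorelTriple L N v).P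
        (Representation.twist (((Representation.trivial ℂ ↥(torusU (conjLocal L (IsCMField.complexConj L) v) (cmLocalForm L N v)) ℂ).twist χ).comp
          (cmBorelTriple L N v).proj) (rootDeltaChar (cmBorelTriple L N v).P))), (∀ f, f ∈ N' → P f = f) ∧ (∀ f, f ∈ N'' → P f = 0) ∧
      (∀ f, P f ∈ N') ∧ (∀ f, f - P f ∈ N'') :=
    ⟨N'.toSubmodule.projection N''.toSubmodule hc', fun f hf => Submodule.projection_apply_of_mem_left hc' hf,
      fun f hf => Submodule.projection_apply_of_mem_right hc' hf, fun f => Submodule.projection_apply_mem hc' f,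
      fun f => Submodule.sub_projection_mem hc' f⟩
  refine ⟨P, fun g f => ?_, hP1, hP2⟩
  have h1 : P (cmPrincipalSeries L N v χ g (P f)) = cmPrincipalSeries L N v χ g (P f) := hP1 _ (N'.apply_mem_toSubmodule g (hPm f))
  have h2 : P (cmPrincipalSeries L N v χ g (f - P f)) = 0 := hP2 _ (N''.apply_mem_toSubmodule g (hPs f))
  have e1 : cmPrincipalSeries L N v χ g (P f + (f - P f)) =
      cmPrincipalSeries L N v χ g (P f) + cmPrincipalSeries L N v χ g (f - P f) := LinearMap.map_add _ _ _
  have e2 : P (cmPrincipalSeries L N v χ g (P f) + cmPrincipalSeries L N v χ g (f - P f)) =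
      P (cmPrincipalSeries L N v χ g (P f)) + P (cmPrincipalSeries L N v χ g (f - P f)) := LinearMap.map_add _ _ _
  have e0 : P (cmPrincipalSeries L N v χ g f) = P (cmPrincipalSeries L N v χ g (P f + (f - P f))) :=
    congrArg (fun x => P (cmPrincipalSeries L N v χ g x)) (add_sub_cancel (P f) f).symm
  have e3 : P (cmPrincipalSeries L N v χ g (P f)) + P (cmPrincipalSeries L N v χ g (f - P f)) =
      cmPrincipalSeries L N v χ g (P f) + 0 := congrArg₂ (· + ·) h1 h2
  exact ((e0.trans ((congrArg P e1).trans e2)).trans e3).trans (add_zero _)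

set_option synthInstance.maxHeartbeats 400000 in
set_option maxHeartbeats 8000000 in
-- statement∕proof-heavy: the `SmoothInd` carrier of `cmPrincipalSeries` (class of ★ `F0P2nFrobeniusFunctional` §4)
/-- **`ev₁ ∘ P` is not proportional to `ev₁`** when `P` fixes the non-zero `N'` and kills the non-zero `N''`: `ev₁ ∘ P = c · ev₁` forces `ev₁ = 0` on `N'` (`c = 0`) or on
`N''` (`c ≠ 0`), contradicting `eq_bot_of_forall_toFun_one_eq_zero`.  [cite: BernsteinZelevinsky1977, Prop. 1.9 (c)] -/
theorem not_proportional_toFun_one_comp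
    (χ : ↥(torusU (conjLocal L (IsCMField.complexConj L) v) (cmLocalForm L N v)) →* ℂˣ)
    (N' N'' : Subrepresentation (cmPrincipalSeries L N v χ)) (hb : N' ≠ ⊥) (hb' : N'' ≠ ⊥) :
    haveI := locallyCompactSpace_cmBorelU L N v
    ∀ (P : Module.End ℂ (Representation.SmoothInd (cmBorelTriple L N v).P
        (Representation.twist (((Representation.trivial ℂ ↥(torusU (conjLocal L (IsCMField.complexConj L) v) (cmLocalForm L N v)) ℂ).twist χ).comp
          (cmBorelTriple L N v).proj) (rootDeltaChar (cmBorelTriple L N v).P))))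
      (ℓ : Representation.SmoothInd (cmBorelTriple L N v).P
        (Representation.twist (((Representation.trivial ℂ ↥(torusU (conjLocal L (IsCMField.complexConj L) v) (cmLocalForm L N v)) ℂ).twist χ).comp
          (cmBorelTriple L N v).proj) (rootDeltaChar (cmBorelTriple L N v).P)) →ₗ[ℂ] ℂ),
      (∀ f, f ∈ N' → P f = f) → (∀ f, f ∈ N'' → P f = 0) → (∀ f, ℓ f = (P f).toFun 1) →
      ∀ c : ℂ, ∃ f, ℓ f ≠ c * f.toFun 1 := by
  haveI := locallyCompactSpace_cmBorelU L N v
  intro P ℓ hP1 hP2 hℓ c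
  by_contra hall
  push Not at hall
  by_cases hc0 : c = 0
  · -- `ev₁` vanishes on `N'`
    refine hb (eq_bot_of_forall_toFun_one_eq_zero L N v χ N' fun f hf => ?_)
    have h := hall f
    rw [hℓ, hP1 f hf, hc0, zero_mul] at h
    exact h
  · -- `ev₁` vanishes on `N''`
    refine hb' (eq_bot_of_forall_toFun_one_eq_zero L N v χ N'' fun f hf => ?_)
    have h := hall f
    rw [hℓ, hP2 f hf] at h
    have h0 : (0 : Representation.SmoothInd (cmBorelTriple L N v).P
        (Representation.twist (((Representation.trivial ℂ ↥(torusU (conjLocal L (IsCMField.complexConj L) v) (cmLocalForm L N v)) ℂ).twist χ).comp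
          (cmBorelTriple L N v).proj) (rootDeltaChar (cmBorelTriple L N v).P))).toFun 1 = 0 := by
      rw [← zero_smul ℂ f, Representation.SmoothInd.toFun_smul, Pi.smul_apply, zero_smul]
    rw [h0] at h
    exact (mul_eq_zero.1 h.symm).resolve_left hc0

set_option synthInstance.maxHeartbeats 400000 in
set_option maxHeartbeats 8000000 in
-- statement∕proof-heavy: the `SmoothInd` carrier of `cmPrincipalSeries` (class of ★ `F0P2nFrobeniusFunctional` §4)
/-- **«SECOND EIGENFUNCTIONAL ⟸ REDUCIBLE», completely reducible case.**  If `I = i_G(χ)` = ★ `cmPrincipalSeries L N v χ` is semisimple (every subrepresentation has an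
invariant complement — e.g. `|χ| = 1`, ★ «PS-UNITARY★») and has a `G`-stable `⊥ ≠ N' ≠ ⊤`, then `I` carries a `(B, χ δ_B^{1/2})`-eigenfunctional NOT proportional to evaluation at
one: `ℓ := ev₁ ∘ pr_{N'}` for the projection along an invariant complement `N''` (a `G`-map, so `ℓ` is an eigenfunctional by `toFun_one_apply_borel`); `ℓ = c · ev₁` would make
`ev₁` vanish on `N'` (`c = 0`) or on `N''` (`c ≠ 0`).  For UNITARY `χ` (semisimple `I`): reducible ⟺ `End_G(I) ≠ ℂ` ⟺ `dim Hom_T(r_B I, χ δ_B^{1/2}) ≥ 2` ⟺ a second eigenfunctional.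
[cite: BernsteinZelevinsky1976, Proposition 2.28; 2.25 (c)] [cite: Casselman1995, §3.2] -/
theorem exists_eigenfunctional_of_ne_bot_ne_top
    (χ : ↥(torusU (conjLocal L (IsCMField.complexConj L) v) (cmLocalForm L N v)) →* ℂˣ)
    (hss : (cmPrincipalSeries L N v χ).IsSemisimpleRepresentation)
    (N' : Subrepresentation (cmPrincipalSeries L N v χ)) (hb : N' ≠ ⊥) (ht : N' ≠ ⊤) :
    haveI := locallyCompactSpace_cmBorelU L N v
    ∃ ℓ : Representation.SmoothInd (cmBorelTriple L N v).P
        (Representation.twist (((Representation.trivial ℂ ↥(torusU (conjLocal L (IsCMField.complexConj L) v) (cmLocalForm L N v)) ℂ).twist χ).comp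
          (cmBorelTriple L N v).proj) (rootDeltaChar (cmBorelTriple L N v).P)) →ₗ[ℂ] ℂ,
      (∀ (p : ↥(cmBorelTriple L N v).P) (f : _),
        ℓ (cmPrincipalSeries L N v χ p.1 f) =
          ((χ ((cmBorelTriple L N v).proj p) : ℂˣ) : ℂ) * ((rootDeltaChar (cmBorelTriple L N v).P p : ℂˣ) : ℂ) * ℓ f) ∧
      ∀ c : ℂ, ∃ f, ℓ f ≠ c * f.toFun 1 := by
  haveI := locallyCompactSpace_cmBorelU L N v
  haveI := hss
  obtain ⟨N'', hc⟩ := exists_isCompl N'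
  have hN''b : N'' ≠ ⊥ := fun h => ht (eq_top_of_isCompl_bot (h ▸ hc))
  obtain ⟨P, hPG, hP1, hP2⟩ := exists_equivariant_projection L N v χ N' N'' hc
  -- `ev₁` as an opaque linear functional, and `ℓ := ev₁ ∘ P`
  obtain ⟨ev, hev⟩ : ∃ ev : Representation.SmoothInd (cmBorelTriple L N v).P
        (Representation.twist (((Representation.trivial ℂ ↥(torusU (conjLocal L (IsCMField.complexConj L) v) (cmLocalForm L N v)) ℂ).twist χ).comp
          (cmBorelTriple L N v).proj) (rootDeltaChar (cmBorelTriple L N v).P)) →ₗ[ℂ] ℂ, ∀ f, ev f = f.toFun 1 :=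
    ⟨{ toFun := fun f => f.toFun 1
       map_add' := fun f g => by rw [Representation.SmoothInd.toFun_add]; rfl
       map_smul' := fun c f => by rw [Representation.SmoothInd.toFun_smul]; rfl }, fun f => rfl⟩
  refine ⟨ev ∘ₗ P, fun p f => ?_,
    not_proportional_toFun_one_comp L N v χ N' N'' hb hN''b P (ev ∘ₗ P) hP1 hP2 fun f => by simp only [LinearMap.comp_apply, hev]⟩
  -- (`simp only`, not `rw`: keyed matching at reducible transparency keeps the `SmoothInd` carrier folded)
  have e := toFun_one_apply_borel L N v χ p (P f)
  simp only [LinearMap.comp_apply, hPG, hev]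
  exact e

set_option synthInstance.maxHeartbeats 400000 in
set_option maxHeartbeats 8000000 in
-- statement∕proof-heavy: the `SmoothInd` carrier of `cmPrincipalSeries` (class of ★ «PS-UNITARY★»)
/-- **The unitary case**: for `|χ| = 1` (★ «PS-UNITARY★» makes `i_G(χ)` completely reducible), `i_G(χ)` is REDUCIBLE IFF it carries a `(B, χ δ_B^{1/2})`-eigenfunctional not
proportional to evaluation at one — i.e. iff `dim End_G i_G(χ) ≥ 2` (Frobenius).  [cite: BernsteinZelevinsky1976, Proposition 2.28; 2.25 (c)] [cite: Casselman1995, §3.2, §6.4] -/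
theorem exists_ne_bot_ne_top_iff_exists_eigenfunctional_of_norm_eq_one
    (χ : ↥(torusU (conjLocal L (IsCMField.complexConj L) v) (cmLocalForm L N v)) →* ℂˣ) (hχu : ∀ t, ‖((χ t : ℂˣ) : ℂ)‖ = 1) :
    haveI := locallyCompactSpace_cmBorelU L N v
    (∃ N' : Subrepresentation (cmPrincipalSeries L N v χ), N' ≠ ⊥ ∧ N' ≠ ⊤) ↔
      ∃ ℓ : Representation.SmoothInd (cmBorelTriple L N v).P
        (Representation.twist (((Representation.trivial ℂ ↥(torusU (conjLocal L (IsCMField.complexConj L) v) (cmLocalForm L N v)) ℂ).twist χ).comp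
          (cmBorelTriple L N v).proj) (rootDeltaChar (cmBorelTriple L N v).P)) →ₗ[ℂ] ℂ,
      (∀ (p : ↥(cmBorelTriple L N v).P) (f : _),
        ℓ (cmPrincipalSeries L N v χ p.1 f) =
          ((χ ((cmBorelTriple L N v).proj p) : ℂˣ) : ℂ) * ((rootDeltaChar (cmBorelTriple L N v).P p : ℂˣ) : ℂ) * ℓ f) ∧
      ∀ c : ℂ, ∃ f, ℓ f ≠ c * f.toFun 1 := by
  haveI := locallyCompactSpace_cmBorelU L N v
  constructor
  · rintro ⟨N', hb, ht⟩
    exact exists_eigenfunctional_of_ne_bot_ne_top L N v χ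
      (F0P3cStCharTSPrincipalSeriesUnitary.isSemisimpleRepresentation_cmPrincipalSeries L N v χ hχu) N' hb ht
  · rintro ⟨ℓ, hℓ, hind⟩
    exact exists_ne_bot_ne_top_of_eigenfunctional L N v χ ℓ hℓ hind

end CM

end Summit.HodgeConjecture.HodgeConjecture.Cruxes.H413.F0P3cStCharTSRedOfEigenfunctional

end
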